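import Mathlib
import Literature.NumberTheory.LFunctions.Zhang2022.SkeletonPartTwo
import Literature.NumberTheory.LFunctions.Zhang2022.SkeletonPartOne
import Literature.NumberTheory.LFunctions.Zhang2022.SkeletonReductions
import Literature.NumberTheory.LFunctions.RHWave0DeuringHeilbronnProofs
import HarnessLib

/-!
# Zhang (2022), typed skeleton IX: Part III nodes — §12 (`Ξ₁₃ = Ξ₁₄ + Ξ₁₅`, (12.17)), §13
# ((13.3), (13.7), (13.11)), §14 (Proposition 14.1), §§15–17 ((15.24), (16.17), (17.10),
# Lemma 17.1, Lemma 15.1), the composition (18.1), and the whole DAG `theorem1_of_leaves`,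
# kernel-checked

Topic `Literature/NumberTheory/LFunctions/Zhang2022` (Landau–Siegel audit tree; verdict-neutral).
Y. Zhang, *Discrete mean estimates and the Landau–Siegel zero*, arXiv:2211.02515v1 (2022)
[Zhang2022LandauSiegel] — **an unrefereed manuscript under adjudication; every `def … : Prop` below
is a CLAIM OF THE MANUSCRIPT, STATED NOT ASSERTED**, except where a `_holds` theorem discharges it.
Kernel-checked here:

* `xi13_eq_xi14_add_xi15` — **(12.3)** `Ξ₁₃ = Ξ₁₄ + Ξ₁₅` from (12.1)–(12.2) (definitional split);
* `eval137_of` — (13.7) with `O(𝔈)` and (13.11) `𝔈 = o(𝔓)` ⇒ `Ξ₁₄ = −i(Φ₁+Φ₂−Φ₃) + o(𝔓)`;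
* `eval181_of_parts` — **§18 (18.1)**: "By (12.3), (12.17), (13.7), (15.24), (16.17) and (17.10),
  `Ξ₁₃ = 𝔠₃𝔞𝔓`" with `𝔠₃ = −i(3𝔢₁ + 3𝔢₂ + 𝔢₃ + 𝔢₀) + e₁* + 2e₂*` (+ rounding `ε`): the
  linear combination is checked and yields exactly the node `Eval181` of `SkeletonPropositions`;
* `appBLemma171_holds` — **Lemma 17.1 (Appendix B) is a theorem of the tree** (`Lemma171.lemma_17_1`);
* `lemma55_holds` — **Lemma 5.5 is a theorem of the tree**: the Deuring–Heilbronn phenomenon, which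
  the manuscript invokes without proof, is PROVED in the tree (`deuring_heilbronn_holds`, Bombieri's
  Théorème 14), and `SkeletonPartOneB.lemma55_holds_of` turns it into the node;
* `theorem1_of_leaves`, `theorem2_of_leaves` — **the whole DAG in one implication**: Theorems 1–2
  from exactly the LEAF claims of the manuscript as typed (the §§3–6 lemmas, `Ded22`/`Ded23`,
  Prop. 7.1 and Lemma 8.1 through the deductions `Ded71`/`Ded81` from their cited inputs,
  Lemmas 8.3–8.4, 10.1–10.2, 11.1–11.2, 15.1, Prop. 14.1, (13.7)/(13.11), the section-level
  computations `Ded…`, and the numerical margin `Margin232`), every edge kernel-checked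
  (`SkeletonAssembly`, `SkeletonReductions`, this file) and every node that is a theorem of the
  tree (Lemmas 3.1, 5.5, 5.6, 5.7, 5.8, 8.2, 17.1, `ψχ` primitive, `𝔷(ψ)` finite, `|𝔡′ + 𝔡| > 5`)
  discharged inside — so NO external named fact remains; the one REFUTED leaf is `Margin232`
  (`SkeletonAssembly.not_margin232`; here `margin_fails_all_roundings` for every admissible rounding
  term): the theorem records precisely where the printed chain fails and everything else it rests on.

| node | locator | printed claim |
|---|---|---|
| `Eval1217 c′` | §12 (12.17) | `Ξ₁₅ = (e₁* + 2e₂* + ε)𝔞𝔓`, `|ε| < 10⁻⁵` |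
| `Lemma121 c′`, `Lemma123 c′` (objects `P1pp`, `P2pp`, `vk13`) | §12 Lemmas 12.1, 12.3 | the three ranges for `Σ_l χ(l)ϰ₁₃(dl)l^{β_j−1}`; `Σ_l χ(l)ϰ̄₁₃(drl)ξ_j(l;d,r)/l` with `|ε| < 10⁻⁵` |
| `Eq137 c′ c₀`, `Eq1311 c′ c₀`, `Eval137 c′` | §13 (13.7), (13.11) | `Ξ₁₄ = −i(Φ₁+Φ₂−Φ₃) + O(𝔈)`; "we can verify that `𝔈 = o(𝔓)`" |
| `Prop141` | §14 Prop. 14.1 | mean-value formula II for `Θ₂(β,𝐤*,𝐚*)`, `|β| < 5α` (printed proof: `β = 0` only) |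
| `Eval1524 c′`, `Eval1617 c′`, `Eval1710 c′` | (15.24), (16.17), (17.10) | `Φ₁ = (𝔢₁+2𝔢₂+𝔢₃)𝔞𝔓 + o(𝔓)`, `Φ₂ = (𝔢₁+𝔢₂)𝔞𝔓 + o(𝔓)`, `Φ₃ = −(𝔢₀+𝔢₁)𝔞𝔓 + o(𝔓)` |
| `AppBLemma171` | §17 Lemma 17.1 (App. B) | `Σ_{n<D⁴} ν(n)²/n = 𝔞 + o(1)` |
| `Lemma151 c′` (objects `bcoef`, `frakq`, `varrhoStar`) | §15 Lemma 15.1 (App. B) | `Σ_{(n,𝔮)=1} b(n₁n)χ(n)ϱ*_j(n)/n = χ(n₁)τ₂(n₁)𝔢_j + O(α₁τ₂(n₁))` |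
| `Ded1217 c′`, `Ded1524 c′`, `Ded1617 c′`, `Ded1710 c′` | §12; §15 + App. A; §16; §17 | the section computations as named implications (Lemmas 12.1–12.3, 15.2–15.3, 16.1–16.2 internal) |
| `Ded71 c′`, `Ded81 c′` | §7 pp. 13–15; §8 p. 16 | the proofs of Prop. 7.1 (from Prop. 2.1, Lemma 3.3, Lemmas 5.1–5.4, 5.6) and of Lemma 8.1 (from Prop. 2.2, Lemma 3.3, Lemmas 5.2, 5.9, 6.1) as named implications |

The constants `e₁*, e₂*, 𝔢_j, 𝔢₀` are the tree's `e1star`, `e2star`, `frake j`, `frake0`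
(`Section18Defs`); `𝔠₃` is its `frakc3`.

## References

* Y. Zhang, arXiv:2211.02515v1 (2022), §2 p. 6 (proof of Theorem 1), §§7–8, §§12–17, §18
  (18.1), Appendices A–B. [cite: Zhang2022LandauSiegel, §§2–18]
-/

noncomputable section

open Complex Real ComplexConjugate

namespace Literature.NumberTheory.LFunctions.Zhang2022.Skeleton

/-! ## §12: the split `H₁₁ = H₁₄ + H₁₅`, `Ξ₁₃ = Ξ₁₄ + Ξ₁₅` -/

section SectionTwelve

variable (c' : ℝ) {D : ℕ} [NeZero D] (χ : DirichletCharacter ℂ D) (x : Chr D)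

/-- **`H₁₄(s,ψ) = Σ_{n<P^{1/2}} ϰ₁(n)ψχ(n)n^{−s}`** (12.1). [cite: Zhang2022LandauSiegel, §12 (12.1)] -/
def H14 (s : ℂ) : ℂ :=
  ∑ n ∈ (Finset.Ico 1 ⌈P1 D⌉₊).filter (fun n : ℕ => (n : ℝ) < bigP D ^ (1 / 2 : ℝ)),
    vk1 D n * pc χ x n * (n : ℂ) ^ (-s)

/-- **`H₁₅(s,ψ) = Σ_{P^{1/2}≤n<P₁} ϰ₁(n)ψχ(n)n^{−s}`** (12.1). [cite: Zhang2022LandauSiegel, §12 (12.1)] -/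
def H15 (s : ℂ) : ℂ :=
  ∑ n ∈ (Finset.Ico 1 ⌈P1 D⌉₊).filter (fun n : ℕ => ¬ (n : ℝ) < bigP D ^ (1 / 2 : ℝ)),
    vk1 D n * pc χ x n * (n : ℂ) ^ (-s)

/-- **`B(s,ψ) = (H₁₄(s,ψ) + ι₂H₁₂(s,ψ))H₂(s,ψ)`** (12.2). [cite: Zhang2022LandauSiegel, §12 (12.2)] -/
def Bpoly (s : ℂ) : ℂ := (H14 χ x s + iota2 * H12 χ x s) * H2 χ x s

/-- **`Ξ₁₄ = ΣΣ𝔠*Z(ρ,ψχ)⁻¹B(ρ,ψ)ω(ρ)`** (12.4). [cite: Zhang2022LandauSiegel, §12 (12.4)] -/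
def xi14 : ℂ := ∑ i ∈ idx χ, cstar c' D i.1 i.2 * (Zpc χ i.1 i.2)⁻¹ * Bpoly χ i.1 i.2 * omegaW D i.2

/-- **`Ξ₁₅ = ΣΣ𝔠*Z(ρ,ψχ)⁻¹H₁₅(ρ,ψ)H₂(ρ,ψ)ω(ρ)`** (12.5). [cite: Zhang2022LandauSiegel, §12 (12.5)] -/
def xi15 : ℂ := ∑ i ∈ idx χ, cstar c' D i.1 i.2 * (Zpc χ i.1 i.2)⁻¹ *
  (H15 χ i.1 i.2 * H2 χ i.1 i.2) * omegaW D i.2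

omit [NeZero D] in
/-- **(12.1)**: `H₁₁ = H₁₄ + H₁₅`. [cite: Zhang2022LandauSiegel, §12 (12.1)] -/
theorem H11_eq_H14_add_H15 (s : ℂ) : H11 χ x s = H14 χ x s + H15 χ x s := by
  rw [H11, H14, H15]
  exact (Finset.sum_filter_add_sum_filter_not _ _ _).symm

/-- **(12.3)**: `Ξ₁₃ = Ξ₁₄ + Ξ₁₅` (from `H₁H₂ = B + H₁₅H₂`, (12.1)–(12.2)). Kernel-checked.
[cite: Zhang2022LandauSiegel, §12 (12.3)] -/
theorem xi13_eq_xi14_add_xi15 : xi13 c' χ = xi14 c' χ + xi15 c' χ := by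
  rw [xi13, xi14, xi15, ← Finset.sum_add_distrib]
  refine Finset.sum_congr rfl fun i _ => ?_
  rw [H1, H11_eq_H14_add_H15, Bpoly]
  ring

/-- **`P″₁ = P^{0.496}Dt₀`, `P″₂ = P^{0.5}Dt₀`** (§12 p. 24). [cite: Zhang2022LandauSiegel, §12 p. 24] -/
def P1pp (D : ℕ) : ℝ := bigP D ^ (0.496 : ℝ) * D * t0 D

/-- `P″₂ = P^{0.5}Dt₀` (§12 p. 24). [cite: Zhang2022LandauSiegel, §12 p. 24] -/
def P2pp (D : ℕ) : ℝ := bigP D ^ (0.5 : ℝ) * D * t0 D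

omit [NeZero D] in
/-- **`ϰ₁₃(n) = (log P₁)⁻¹(n/P″₁)^{−β₆}log(n/P″₁)`** for `P″₁ < n < P″₂`, else `0` (display after
(12.9)). [cite: Zhang2022LandauSiegel, §12 (12.9)] -/
def vk13 (D : ℕ) (n : ℕ) : ℂ :=
  if P1pp D < n ∧ (n : ℝ) < P2pp D then
    ((Real.log (P1 D))⁻¹ : ℝ) * ((n / P1pp D : ℝ) : ℂ) ^ (-beta6 D) * (Real.log (n / P1pp D) : ℂ)
  else 0

/-- **Lemma 12.1** (§12 p. 25; `1 ≤ j ≤ 3`): "`Σ_l χ(l)ϰ₁₃(dl)/l^{1−β_j} ≪ T^{−c}` if `d ≤ P″₁/T`,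
`≪ α₁` if `P″₁/T < d ≤ P″₁`, and `= (L′(1,χ)/log P₁)(−1 + (2β₆ − β_j)log(d/P″₁) + ε₁ⱼ(d))`,
`|ε₁ⱼ(d)| < 10⁻⁵`, if `P″₁ < d < P₂`" (the `l`-sum is finite: `dl < P″₂`; `α₁` read as `α𝓛`; the
third assertion typed as `‖Σ − (L′/log P₁)(−1 + (2β₆−β_j)log(d/P″₁))‖ ≤ 10⁻⁵|L′(1,χ)|/log P₁`).
CLAIM (a proof-internal input of (12.17), kept as a node for the adjudication).
[cite: Zhang2022LandauSiegel, §12 Lemma 12.1] -/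
def Lemma121 : Prop :=
  ∃ c : ℝ, 0 < c ∧ ∃ C : ℝ, ForAllLarge fun D _ χ => AssumptionA D χ →
    ∀ j ∈ ({1, 2, 3} : Finset ℕ), ∀ d : ℕ, 1 ≤ d →
      let S : ℂ := ∑ l ∈ Finset.Ico 1 ⌈P2pp D⌉₊,
        χ (l : ZMod D) * vk13 D (d * l) / (l : ℂ) ^ (1 - betaJ c' D j)
      ((d : ℝ) ≤ P1pp D / bigT D → ‖S‖ ≤ C * bigT D ^ (-c)) ∧
      (P1pp D / bigT D < d → (d : ℝ) ≤ P1pp D → ‖S‖ ≤ C * alpha D * ell D) ∧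
      (P1pp D < d → (d : ℝ) < P2 D →
        ‖S - deriv χ.LFunction 1 / Real.log (P1 D) *
            (-1 + (2 * beta6 D - betaJ c' D j) * (Real.log (d / P1pp D) : ℂ))‖ ≤
          1e-5 * ‖deriv χ.LFunction 1‖ / Real.log (P1 D))

/-- **Lemma 12.3** (§12 p. 25; `1 ≤ j ≤ 3`): "If `P″₁ < dr < P₂`, then
`Σ_l χ(l)ϰ̄₁₃(drl)ξ_j(l;d,r)/l = (L′(1,χ)Π(d,r)/log P₁)(−1 + (−2β₆ + β_{j+1} + β_{j+2})log(dr/P″₁)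
+ ε₂ⱼ(dr))`, `|ε₂ⱼ(dr)| < 10⁻⁵`" (`ϰ̄₁₃` = complex conjugate, cf. `𝐚₂₅ = conj 𝐚₁₅`; `ξ_j(l;d,r)` read
as the `ξ₀ⱼ(l;d,r)` of §§7–8, the tree-backed `xiZero`; typed as a bound
`≤ 10⁻⁵|L′(1,χ)||Π(d,r)|/log P₁`). CLAIM (proof-internal input of (12.17), kept as a node).
[cite: Zhang2022LandauSiegel, §12 Lemma 12.3] -/
def Lemma123 : Prop :=
  ForAllLarge fun D _ χ => AssumptionA D χ →
    ∀ j ∈ ({1, 2, 3} : Finset ℕ), ∀ d r : ℕ, 1 ≤ d → 1 ≤ r → P1pp D < ((d * r : ℕ) : ℝ) →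
      ((d * r : ℕ) : ℝ) < P2 D →
        ‖(∑ l ∈ Finset.Ico 1 ⌈P2pp D⌉₊,
            χ (l : ZMod D) * conj (vk13 D (d * r * l)) * xiZero c' D j l d r / (l : ℂ)) -
          deriv χ.LFunction 1 * PiW χ d r / Real.log (P1 D) *
            (-1 + (-2 * beta6 D + betaJ c' D (j + 1) + betaJ c' D (j + 2)) *
              (Real.log (((d * r : ℕ) : ℝ) / P1pp D) : ℂ))‖ ≤
          1e-5 * ‖deriv χ.LFunction 1‖ * ‖PiW χ d r‖ / Real.log (P1 D)

/-- **(12.17)** (§12 pp. 24–26, via (12.6)–(12.16), Lemmas 12.1–12.3): "`Ξ₁₅ = (e₁* + 2e₂* + ε)𝔞𝔓`"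
with the rounding term `|ε| < 10⁻⁵` (typed as the slack `10⁻⁵·𝔞𝔓`) and the suppressed `o(𝔓)`;
`e₁*, e₂*` are the tree's `e1star`, `e2star`. CLAIM. [cite: Zhang2022LandauSiegel, §12 (12.17)] -/
def Eval1217 : Prop :=
  ∀ ε : ℝ, 0 < ε → ForAllLarge fun D _ χ => AssumptionA D χ →
    ‖xi15 c' χ - (e1star + 2 * e2star) * frakA χ * frakP D‖ ≤ 1e-5 * frakA χ * frakP D + ε * frakP D

end SectionTwelve

/-! ## §13: `𝔨*ⱼ`, `Φ₁, Φ₂, Φ₃`, `E₁*`, `𝔈`, (13.7) and (13.11) -/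

section SectionThirteen

variable (c' c₀ : ℝ) {D : ℕ} [NeZero D] (χ : DirichletCharacter ℂ D) (x : Chr D)

/-- **`𝔨*₁(ρ,ψ) = Z(ρ,ψχ)⁻¹ L(ρ+β₁,ψ)L(ρ+β₂,ψ)/L′(ρ,ψ) · B(ρ,ψ)K(1−ρ−β₃,ψ̄)`** (13.4).
[cite: Zhang2022LandauSiegel, §13 (13.4)] -/
def kstar1 (ρ : ℂ) : ℂ :=
  (Zpc χ x ρ)⁻¹ * (x.ψ.LFunction (ρ + beta1 c' D) * x.ψ.LFunction (ρ + beta2 c' D) /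
    deriv x.ψ.LFunction ρ) * Bpoly χ x ρ * Kchar D (psiBarFn x) (1 - ρ - beta3 c' D)

/-- **`𝔨*₂(ρ,ψ) = Z(ρ,ψχ)⁻¹ L(ρ+β₁,ψ)/L′(ρ,ψ) · B(ρ,ψ)N(ρ+β₃,ψ)K(1−ρ−β₂,ψ̄)`** (13.5).
[cite: Zhang2022LandauSiegel, §13 (13.5)] -/
def kstar2 (ρ : ℂ) : ℂ :=
  (Zpc χ x ρ)⁻¹ * (x.ψ.LFunction (ρ + beta1 c' D) / deriv x.ψ.LFunction ρ) * Bpoly χ x ρ *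
    Nchar D (psiFn x) (ρ + beta3 c' D) * Kchar D (psiBarFn x) (1 - ρ - beta2 c' D)

/-- **`𝔨*₃(ρ,ψ) = L(ρ+β₁,ψ)/L′(ρ,ψ) · B(ρ,ψ)G(ρ,ψ)N(ρ+β₂,ψ)N(ρ+β₃,ψ)F(1−ρ,ψ̄)`** (13.6).
[cite: Zhang2022LandauSiegel, §13 (13.6)] -/
def kstar3 (ρ : ℂ) : ℂ :=
  (x.ψ.LFunction (ρ + beta1 c' D) / deriv x.ψ.LFunction ρ) * Bpoly χ x ρ * Gpoly χ x ρ *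
    Nchar D (psiFn x) (ρ + beta2 c' D) * Nchar D (psiFn x) (ρ + beta3 c' D) * FpolyBar χ x (1 - ρ)

/-- **`Φ₁ = ΣΣ𝔨*₁(ρ,ψ)ω(ρ)`** (13.8). [cite: Zhang2022LandauSiegel, §13 (13.8)] -/
def Phi1 : ℂ := ∑ i ∈ idx χ, kstar1 c' χ i.1 i.2 * omegaW D i.2

/-- **`Φ₂ = Σ_ψ (p_ψt₀)^{β₁} Σ_ρ 𝔨*₂(ρ,ψ)ω(ρ)`** (13.9). [cite: Zhang2022LandauSiegel, §13 (13.9)] -/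
def Phi2 : ℂ := ∑ i ∈ idx χ,
  (((i.1.p : ℝ) * t0 D : ℝ) : ℂ) ^ beta1 c' D * kstar2 c' χ i.1 i.2 * omegaW D i.2

/-- **`Φ₃ = Σ_ψ (p_ψt₀)^{β₃} Σ_ρ 𝔨*₃(ρ,ψ)ω(ρ)`** (13.10). [cite: Zhang2022LandauSiegel, §13 (13.10)] -/
def Phi3 : ℂ := ∑ i ∈ idx χ,
  (((i.1.p : ℝ) * t0 D : ℝ) : ℂ) ^ beta3 c' D * kstar3 c' χ i.1 i.2 * omegaW D i.2

/-- `E₁(s,ψ)` of Lemma 6.1 with its `ε = exp{−c₀𝓛¹⁰}` made a parameter.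
[cite: Zhang2022LandauSiegel, §6 Lemma 6.1] -/
def E1full (s : ℂ) : ℝ := E1main x s + Real.exp (-c₀ * ell D ^ 10)

/-- **`E₁*(ρ,ψ)`** (display after (13.3)). [cite: Zhang2022LandauSiegel, §13 (13.3)] -/
def E1star (ρ : ℂ) : ℝ :=
  ‖x.ψ.LFunction (ρ + beta1 c' D) * x.ψ.LFunction (ρ + beta2 c' D) / deriv x.ψ.LFunction ρ‖ *
      (‖x.ψ.LFunction (ρ + beta3 c' D)‖ * (t0 D)⁻¹ +
        ‖Nchar D (psiFn x) (ρ + beta3 c' D)‖ * (ell D ^ 123)⁻¹ + E1full c₀ x (ρ + beta3 c' D)) +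
    ‖x.ψ.LFunction (ρ + beta1 c' D) * Nchar D (psiFn x) (ρ + beta3 c' D) / deriv x.ψ.LFunction ρ‖ *
      (‖Nchar D (psiFn x) (ρ + beta2 c' D)‖ * (ell D ^ 123)⁻¹ + E1full c₀ x (ρ + beta2 c' D))

/-- **`𝔈 = ΣΣE₁*(ρ,ψ)|B(ρ,ψ)|ω(ρ)`** (display after (13.10); `ω(ρ) > 0` on the critical line, here
`|ω(ρ)|` so that `𝔈 ≥ 0` by definition). [cite: Zhang2022LandauSiegel, §13 (13.7)] -/
def frakE : ℝ := ∑ i ∈ idx χ, E1star c' c₀ i.1 i.2 * ‖Bpoly χ i.1 i.2‖ * ‖omegaW D i.2‖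

omit [NeZero D] in
/-- `E₁(s,ψ) ≥ 0` (an integral of a non-negative function over `[−𝓛²⁰, 𝓛²⁰]`, times `𝓛⁻⁶⁸ ≥ 0`).
[cite: Zhang2022LandauSiegel, §6 Lemma 6.1] -/
theorem E1main_nonneg (s : ℂ) : 0 ≤ E1main x s := by
  have hℓ : 0 ≤ ell D := Real.log_natCast_nonneg D
  refine mul_nonneg (inv_nonneg.mpr (pow_nonneg hℓ _)) ?_
  refine intervalIntegral.integral_nonneg (by linarith [pow_nonneg hℓ 20]) fun v _ => ?_
  exact mul_nonneg (norm_nonneg _) (Real.exp_nonneg _)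

omit [NeZero D] in
/-- `E₁*(ρ,ψ) ≥ 0`. [cite: Zhang2022LandauSiegel, §13 (13.3)] -/
theorem E1star_nonneg (ρ : ℂ) : 0 ≤ E1star c' c₀ x ρ := by
  have hℓ : 0 ≤ ell D := Real.log_natCast_nonneg D
  have ht : 0 ≤ t0 D := pow_nonneg hℓ _
  have hf3 : 0 ≤ E1full c₀ x (ρ + beta3 c' D) :=
    add_nonneg (E1main_nonneg x _) (Real.exp_nonneg _)
  have hf2 : 0 ≤ E1full c₀ x (ρ + beta2 c' D) :=
    add_nonneg (E1main_nonneg x _) (Real.exp_nonneg _)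
  have hℓ123 : 0 ≤ (ell D ^ 123)⁻¹ := inv_nonneg.mpr (pow_nonneg hℓ _)
  have ht' : 0 ≤ (t0 D)⁻¹ := inv_nonneg.mpr ht
  unfold E1star
  exact add_nonneg
    (mul_nonneg (norm_nonneg _) (add_nonneg (add_nonneg (mul_nonneg (norm_nonneg _) ht')
      (mul_nonneg (norm_nonneg _) hℓ123)) hf3))
    (mul_nonneg (norm_nonneg _) (add_nonneg (mul_nonneg (norm_nonneg _) hℓ123) hf2))

omit [NeZero D] in
/-- `𝔈 ≥ 0`. [cite: Zhang2022LandauSiegel, §13 (13.7)] -/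
theorem frakE_nonneg : 0 ≤ frakE c' c₀ χ :=
  Finset.sum_nonneg fun i _ =>
    mul_nonneg (mul_nonneg (E1star_nonneg c' c₀ i.1 i.2) (norm_nonneg _)) (norm_nonneg _)

/-- **(13.7)** (§13 p. 27; from (13.1)–(13.6), i.e. Lemmas 5.1, 5.2, 6.1, 4.8): "`Ξ₁₄ = −i(Φ₁ + Φ₂
− Φ₃) + O(𝔈)`". CLAIM. [cite: Zhang2022LandauSiegel, §13 (13.7)] -/
def Eq137 : Prop :=
  ∃ C : ℝ, ForAllLarge fun D _ χ => AssumptionA D χ →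
    ‖xi14 c' χ + I * (Phi1 c' χ + Phi2 c' χ - Phi3 c' χ)‖ ≤ C * frakE c' c₀ χ

/-- **(13.11)** (§13 p. 27): "Combining (2.34), Cauchy's inequality, Proposition 7.1, Lemma 5.9,
6.1 and 3.3, we can verify that `𝔈 = o(𝔓)`" (the verification is not carried out in print). CLAIM.
[cite: Zhang2022LandauSiegel, §13 (13.11)] -/
def Eq1311 : Prop :=
  ∀ ε : ℝ, 0 < ε → ForAllLarge fun D _ χ => AssumptionA D χ → frakE c' c₀ χ ≤ ε * frakP D

/-- (13.7) and (13.11) together: `Ξ₁₄ = −i(Φ₁ + Φ₂ − Φ₃) + o(𝔓)`, the form consumed in §18.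
CLAIM. [cite: Zhang2022LandauSiegel, §13 (13.7), (13.11)] -/
def Eval137 : Prop :=
  ∀ ε : ℝ, 0 < ε → ForAllLarge fun D _ χ => AssumptionA D χ →
    ‖xi14 c' χ + I * (Phi1 c' χ + Phi2 c' χ - Phi3 c' χ)‖ ≤ ε * frakP D

/-- **(13.7) + (13.11) ⇒ `Ξ₁₄ = −i(Φ₁+Φ₂−Φ₃) + o(𝔓)`**, kernel-checked bookkeeping.
[cite: Zhang2022LandauSiegel, §13 (13.7), (13.11)] -/
theorem eval137_of (h137 : Eq137 c' c₀) (h1311 : Eq1311 c' c₀) : Eval137 c' := by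
  intro ε hε
  obtain ⟨C, hC⟩ := h137
  obtain ⟨D₀, h⟩ := hC.and (h1311 (ε / (|C| + 1)) (by positivity))
  refine ⟨D₀, fun D _ χ hD hq hp hA => ?_⟩
  obtain ⟨h1, h2⟩ := h D χ hD hq hp
  have hE0 : 0 ≤ frakE c' c₀ χ := frakE_nonneg c' c₀ χ
  have hP : 0 ≤ frakP D := by
    rw [frakP_eq_sum_primeWindow]; exact Finset.sum_nonneg fun p _ => Nat.cast_nonneg p
  calc ‖xi14 c' χ + I * (Phi1 c' χ + Phi2 c' χ - Phi3 c' χ)‖ ≤ C * frakE c' c₀ χ := h1 hA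
    _ ≤ |C| * frakE c' c₀ χ := by gcongr; exact le_abs_self C
    _ ≤ |C| * (ε / (|C| + 1) * frakP D) := by gcongr; exact h2 hA
    _ ≤ ε * frakP D := by
        have : |C| * (ε / (|C| + 1)) ≤ ε := by
          rw [mul_div_assoc', div_le_iff₀ (by positivity)]; nlinarith [abs_nonneg C]
        nlinarith

end SectionThirteen

/-! ## §14: the mean-value formula II -/

section SectionFourteen

variable {D : ℕ} [NeZero D] (χ : DirichletCharacter ℂ D)

/-- **`Θ₂(β,𝐤*,𝐚*) = Σ_{ψ∈Ψ₁}(p_ψt₀)^β (1/2πi)∫_{𝔍(1)} Z(s,ψχ)⁻¹(Σ_mκ*(m)ψ(m)m^{−s})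
(Σ_na*(n)ψ̄(n)n^{s−1})ω(s)ds`** (§14 p. 28; the `m`-sum a series, absolutely convergent on `𝔍(1)`).
[cite: Zhang2022LandauSiegel, §14 p. 28] -/
def Theta2 (β : ℂ) (κs as : ℕ → ℂ) : ℂ :=
  ∑ x ∈ finsetOf (PsiOne χ), (((x.p : ℝ) * t0 D : ℝ) : ℂ) ^ β *
    Lemma81.segInt (t0 D) (ell1 D) 1 fun s =>
      (Zpc χ x s)⁻¹ * (∑' m : ℕ, κs m * x.ψ (m : ZMod x.p) * (m : ℂ) ^ (-s)) *
        (∑ n ∈ Finset.Icc 1 ⌊2 * P4 D⌋₊, as n * conj (x.ψ (n : ZMod x.p)) * (n : ℂ) ^ (s - 1)) *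
        omegaW D s

/-- The main term of Proposition 14.1:
`φ(D)⁻¹ Σ_{p∼P}(pt₀)^β Σ_d d⁻¹ Σ_k μχ(k)a*(dk)/(kφ(k)) Σ_{(l,k)=1} χ(l)κ*(dl)Δ(l/(Dpk))`
(the `l`-sum a series; `d, k ≤ 2P₄` by (14.2)). [cite: Zhang2022LandauSiegel, §14 Prop. 14.1] -/
def main141 (β : ℂ) (κs as : ℕ → ℂ) : ℂ :=
  (Nat.totient D : ℂ)⁻¹ * ∑ p ∈ primeWindow D, (((p : ℝ) * t0 D : ℝ) : ℂ) ^ β *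
    ∑ d ∈ Finset.Icc 1 ⌊2 * P4 D⌋₊, (d : ℂ)⁻¹ *
      ∑ k ∈ Finset.Icc 1 ⌊2 * P4 D⌋₊,
        (ArithmeticFunction.moebius k : ℂ) * χ (k : ZMod D) * as (d * k) / ((k : ℂ) * Nat.totient k) *
          ∑' l : ℕ, if Nat.Coprime l k then
            χ (l : ZMod D) * κs (d * l) * DeltaW D ((l : ℝ) / ((D : ℝ) * p * k)) else 0

/-- **Proposition 14.1** (§14 p. 28, mean-value formula II; "We prove this proposition with `β = 0`
only, as the general case is almost identical"): for `|β| < 5α`, `κ*(m) ≪ τ₅(m)` (14.1), `a*(n) ≪ 1`,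
`a*(n) = 0` for `n > 2P₄` (14.2): "`Θ₂(β,𝐤*,𝐚*) = [main term] + o(𝔓)`". CLAIM.
[cite: Zhang2022LandauSiegel, §14 Prop. 14.1] -/
def Prop141 : Prop :=
  ∀ B : ℝ, ∀ ε : ℝ, 0 < ε → ForAllLarge fun D _ χ => AssumptionA D χ →
    ∀ β : ℂ, ‖β‖ < 5 * alpha D → ∀ κs as : ℕ → ℂ,
      (∀ m, ‖κs m‖ ≤ B * ((ArithmeticFunction.zeta ^ 5 : ArithmeticFunction ℕ) m : ℝ)) →
      (∀ n, ‖as n‖ ≤ B) → (∀ n : ℕ, 2 * P4 D < n → as n = 0) →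
        ‖Theta2 χ β κs as - main141 χ β κs as‖ ≤ ε * frakP D

end SectionFourteen

/-! ## §§15–17: the evaluations of `Φ₁, Φ₂, Φ₃` and Lemma 17.1 -/

section SectionsFifteenToSeventeen

variable (c' : ℝ)

/-- **(15.24)** (§15 pp. 29–32, from Prop. 14.1, Lemmas 15.1–15.3, Appendix A):
"`Φ₁ = (𝔢₁ + 2𝔢₂ + 𝔢₃)𝔞𝔓 + o(𝔓)`" (`𝔢_j` = the tree's `frake j`). CLAIM.
[cite: Zhang2022LandauSiegel, §15 (15.24)] -/
def Eval1524 : Prop :=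
  ∀ ε : ℝ, 0 < ε → ForAllLarge fun D _ χ => AssumptionA D χ →
    ‖Phi1 c' χ - (frake 1 + 2 * frake 2 + frake 3) * frakA χ * frakP D‖ ≤ ε * frakP D

/-- **(16.17)** (§16 pp. 33–34, from Prop. 14.1 with `β = β₁`, Lemmas 16.1–16.2, 15.1):
"`Φ₂ = (𝔢₁ + 𝔢₂)𝔞𝔓 + o(𝔓)`". CLAIM. [cite: Zhang2022LandauSiegel, §16 (16.17)] -/
def Eval1617 : Prop :=
  ∀ ε : ℝ, 0 < ε → ForAllLarge fun D _ χ => AssumptionA D χ →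
    ‖Phi2 c' χ - (frake 1 + frake 2) * frakA χ * frakP D‖ ≤ ε * frakP D

/-- **(17.10)** (§17 pp. 34–36, from Prop. 14.1 with `β = β₃`, (17.2)–(17.9), "A detailed analysis
shows (17.4)", Lemma 17.1): "`Φ₃ = −(𝔢₀ + 𝔢₁)𝔞𝔓 + o(𝔓)`" (`𝔢₀` = the tree's `frake0`, reading
`𝔳𝔨₄ := 𝔳𝔨₂`). CLAIM. [cite: Zhang2022LandauSiegel, §17 (17.10)] -/
def Eval1710 : Prop :=
  ∀ ε : ℝ, 0 < ε → ForAllLarge fun D _ χ => AssumptionA D χ →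
    ‖Phi3 c' χ + (frake0 + frake 1) * frakA χ * frakP D‖ ≤ ε * frakP D

/-- **Lemma 17.1** (§17 p. 35, proved in Appendix B): "`Σ_{n<D⁴} ν(n)²/n = 𝔞 + o(1)`" (typed with
`|ν(n)|² = ν(n)²`, `χ` real). CLAIM — and a THEOREM of the tree (`appBLemma171_holds`, rate `𝓛⁻²⁰¹¹`).
[cite: Zhang2022LandauSiegel, §17 Lemma 17.1] -/
def AppBLemma171 : Prop :=
  ∃ C : ℝ, ForAllLarge fun D _ χ => AssumptionA D χ →
    |∑ n ∈ Finset.range (D ^ 4), ‖nu χ n‖ ^ 2 / n - frakA χ| ≤ C / ell D ^ 2011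

/-- **Lemma 17.1 is a theorem of the tree** (`Lemma171.lemma_17_1`, Appendix B kernel-checked).
[cite: Zhang2022LandauSiegel, §17 Lemma 17.1] -/
theorem appBLemma171_holds : AppBLemma171 := by
  obtain ⟨C, hC⟩ := Lemma171.lemma_17_1
  refine ⟨C, ⌈Real.exp 3⌉₊, fun D _ χ hD hq hp hA => ?_⟩
  have hlog : 3 ≤ Real.log D := by
    have h : Real.exp 3 ≤ D := le_trans (Nat.le_ceil _) (by exact_mod_cast hD)
    exact (Real.le_log_iff_exp_le (lt_of_lt_of_le (Real.exp_pos _) h)).mpr h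
  simpa [nu, ell, frakA] using hC D χ hp hq.sq_eq_one hlog (le_of_lt hA)

/-! ### Appendix B, Lemma 15.1 — the arithmetic sum consumed in §§15, 16, 17 -/

/-- **`b(n)`**, the coefficients of `B(s,ψ) = Σ_n b(n)ψχ(n)n^{−s}` (15.1): by (12.2) and (2.27),
`B = (H₁₄ + ι₂H₁₂)(ῑ₃H₁₃ + ῑ₄H₁₂)` and `ψχ` is completely multiplicative, so `b` is the Dirichlet
convolution of `n ↦ ϰ₁(n)·[n < P^{1/2}] + ι₂ϰ₂(n)` with `n ↦ ῑ₃ϰ₃(n) + ῑ₄ϰ₂(n)`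
("`b(n) ≪ τ₂(n)`, `b(n) = 0` if `n > PT⁻²η₊`", (15.2)). [cite: Zhang2022LandauSiegel, §15 (15.1)–(15.2)] -/
def bcoef (D : ℕ) (n : ℕ) : ℂ :=
  ∑ p ∈ n.divisorsAntidiagonal,
    ((if (p.1 : ℝ) < bigP D ^ (1 / 2 : ℝ) then vk1 D p.1 else 0) + iota2 * vk2 D p.1) *
      (conj iota3 * vk3 D p.2 + conj iota4 * vk2 D p.2)

/-- **`𝔮 = ∏_{q<D⁴} q`** (§15 p. 31): "every `n` can be uniquely written as `n = n₁n₂` with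
`n₁ ∈ 𝔫(𝔮)` and `(n₂, 𝔮) = 1`". [cite: Zhang2022LandauSiegel, §15 p. 31] -/
def frakq (D : ℕ) : ℕ := ∏ q ∈ (Finset.range (D ^ 4)).filter Nat.Prime, q

variable {D : ℕ} (χ : DirichletCharacter ℂ D) in
/-- **`ϱ*_j(n) = Σ_{d∣n} d^{β_j}χ(d)`** (15.21). [cite: Zhang2022LandauSiegel, §15 (15.21)] -/
def varrhoStar (j n : ℕ) : ℂ := ∑ d ∈ n.divisors, (d : ℂ) ^ betaJ c' D j * χ (d : ZMod D)

/-- **Lemma 15.1** (§15 p. 31, "will be proved in Appendix B"; consumed at (15.22), after (16.13),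
and at (17.9)): "Suppose `n₁ ∈ 𝔫(𝔮)` and `n₁ < T`. Then
`Σ_{(n,𝔮)=1} b(n₁n)χ(n)ϱ*_j(n)/n = χ(n₁)τ₂(n₁)𝔢_j + O(α₁τ₂(n₁))` where
`𝔢_j = (e_{1j} + ι₂e_{2j})(ῑ₃e_{3j} + ῑ₄e_{2j})`" with the printed `e_{2j}`, `e_{3j}`,
`e_{1j} = e′_{1j} − e″_{1j}` — the tree's `frake j`, whose `e1ppj` is `e″_{1j}` AS STATED in the
lemma (the last display of the Appendix-B proof gives instead the tree's `e1ppD`, cf.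
`Section18EpsilonIdentity`; the skeleton states the lemma as printed). `1 ≤ j ≤ 3`; `α₁` (undefined
in v1) read as `α𝓛`; `τ₂(n)` = the number of divisors; the `n`-sum is finite by (15.2).
CLAIM. [cite: Zhang2022LandauSiegel, §15 Lemma 15.1] -/
def Lemma151 : Prop :=
  ∃ C : ℝ, ForAllLarge fun D _ χ => AssumptionA D χ → ∀ j ∈ ({1, 2, 3} : Finset ℕ), ∀ n₁ : ℕ,
    n₁ ∈ nset (frakq D) → (n₁ : ℝ) < bigT D →
      ‖(∑ n ∈ (Finset.Ico 1 ⌈bigP D⌉₊).filter (fun n => Nat.Coprime n (frakq D)),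
          bcoef D (n₁ * n) * χ (n : ZMod D) * varrhoStar c' χ j n / (n : ℂ)) -
        χ (n₁ : ZMod D) * (n₁.divisors.card : ℂ) * frake j‖ ≤
      C * alpha D * ell D * n₁.divisors.card

/-! ### The section-level computations of §§12, 15, 16, 17 as named implications -/

/-- **§12 pp. 24–26, (12.6)–(12.16)**: "Proposition 7.1 + Lemma 8.1 + Lemmas 8.2–8.4, 5.8, 12.1, 12.3
(+ Lemma 12.2, whose printed error term is a bare `+O`, internal; and the bounds cited as '(8.25),
(8.26)' for (12.6)) ⇒ (12.17)". CLAIM. [cite: Zhang2022LandauSiegel, §12 (12.6)–(12.17)] -/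
def Ded1217 : Prop :=
  Prop71 c' → Lemma81 c' → Lemma82 c' → Lemma83 c' → Lemma84 c' → Lemma58 → Lemma121 c' →
    Lemma123 c' → Eval1217 c'

/-- **§15, (15.1)–(15.23)**: "Proposition 14.1 + Lemma 5.5 ((15.8): the residue at `ρ̃`) + Lemma 5.8
(`ρ₁*`, `ρ₁ⱼ`) + Lemma 15.1 (App. B) (+ Lemmas 15.2–15.3, App. A, 'we give a sketch only') ⇒
(15.24)". Lemmas 15.2–15.3 are internal to this node. CLAIM.
[cite: Zhang2022LandauSiegel, §15 (15.1)–(15.24)] -/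
def Ded1524 : Prop := Prop141 → Lemma55 → Lemma58 → Lemma151 c' → Eval1524 c'

/-- **§16, (16.1)–(16.16)**: "Proposition 14.1 (at `β = β₁ ≠ 0`) + Lemma 5.5 + Lemma 5.8 + Lemma 15.1
(+ Lemmas 16.1–16.2, App. A, 16.2 'a sketch only') ⇒ (16.17)". Lemmas 16.1–16.2 are internal to this
node. CLAIM. [cite: Zhang2022LandauSiegel, §16 (16.1)–(16.17)] -/
def Ded1617 : Prop := Prop141 → Lemma55 → Lemma58 → Lemma151 c' → Eval1617 c'

/-- **§17, (17.1)–(17.9)**: "Proposition 14.1 (at `β = β₃`) + Lemma 17.1 + Lemma 15.1 ('Hence, by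
Lemma 15.1', (17.9)) (+ 'A detailed analysis shows' (17.4)) ⇒ (17.10)". CLAIM.
[cite: Zhang2022LandauSiegel, §17 (17.1)–(17.10)] -/
def Ded1710 : Prop := Prop141 → AppBLemma171 → Lemma151 c' → Eval1710 c'

end SectionsFifteenToSeventeen

/-! ## §18 (18.1): `Ξ₁₃ = 𝔠₃𝔞𝔓` from its six inputs, kernel-checked -/

/-- **§18 p. 36: "By (12.3), (12.17), (13.7), (15.24), (16.17) and (17.10), `Ξ₁₃ = 𝔠₃𝔞𝔓` (18.1)
with `𝔠₃ = −i(3𝔢₁ + 3𝔢₂ + 𝔢₃ + 𝔢₀) + e₁* + 2e₂* + ε`."** The linear combination is exact: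
`Ξ₁₃ = Ξ₁₄ + Ξ₁₅ = −i[(𝔢₁+2𝔢₂+𝔢₃) + (𝔢₁+𝔢₂) + (𝔢₀+𝔢₁)]𝔞𝔓 + (e₁*+2e₂*)𝔞𝔓 + 10⁻⁵𝔞𝔓 + o(𝔓)`,
and `−i(3𝔢₁+3𝔢₂+𝔢₃+𝔢₀) + e₁* + 2e₂*` is the tree's `frakc3` — so these nodes yield EXACTLY the
node `Eval181`. [cite: Zhang2022LandauSiegel, §18 (18.1)] -/
theorem eval181_of_parts {c' : ℝ} (h1217 : Eval1217 c') (h137 : Eval137 c') (h1524 : Eval1524 c')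
    (h1617 : Eval1617 c') (h1710 : Eval1710 c') : Eval181 c' := by
  intro ε hε
  have hε5 : 0 < ε / 5 := by positivity
  obtain ⟨D₀, h⟩ := ((((h1217 _ hε5).and (h137 _ hε5)).and (h1524 _ hε5)).and (h1617 _ hε5)).and
    (h1710 _ hε5)
  refine ⟨D₀, fun D _ χ hD hq hp hA => ?_⟩
  obtain ⟨⟨⟨⟨e1217, e137⟩, e1524⟩, e1617⟩, e1710⟩ := h D χ hD hq hp
  have g1217 := e1217 hA
  have g137 := e137 hA
  have g1524 := e1524 hA
  have g1617 := e1617 hA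
  have g1710 := e1710 hA
  set X : ℂ := (frakA χ : ℂ) * (frakP D : ℂ) with hX
  -- the exact algebraic identity behind (18.1)
  have key : xi13 c' χ - frakc3 * frakA χ * frakP D =
      (xi14 c' χ + I * (Phi1 c' χ + Phi2 c' χ - Phi3 c' χ)) +
      (-I) * (Phi1 c' χ - (frake 1 + 2 * frake 2 + frake 3) * frakA χ * frakP D) +
      (-I) * (Phi2 c' χ - (frake 1 + frake 2) * frakA χ * frakP D) +
      I * (Phi3 c' χ + (frake0 + frake 1) * frakA χ * frakP D) +
      (xi15 c' χ - (e1star + 2 * e2star) * frakA χ * frakP D) := by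
    rw [xi13_eq_xi14_add_xi15, frakc3]
    ring
  rw [key]
  have nI : ‖(-I : ℂ)‖ = 1 := by simp
  calc ‖(xi14 c' χ + I * (Phi1 c' χ + Phi2 c' χ - Phi3 c' χ)) +
        (-I) * (Phi1 c' χ - (frake 1 + 2 * frake 2 + frake 3) * frakA χ * frakP D) +
        (-I) * (Phi2 c' χ - (frake 1 + frake 2) * frakA χ * frakP D) +
        I * (Phi3 c' χ + (frake0 + frake 1) * frakA χ * frakP D) +
        (xi15 c' χ - (e1star + 2 * e2star) * frakA χ * frakP D)‖
      ≤ ‖xi14 c' χ + I * (Phi1 c' χ + Phi2 c' χ - Phi3 c' χ)‖ +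
        ‖(-I) * (Phi1 c' χ - (frake 1 + 2 * frake 2 + frake 3) * frakA χ * frakP D)‖ +
        ‖(-I) * (Phi2 c' χ - (frake 1 + frake 2) * frakA χ * frakP D)‖ +
        ‖I * (Phi3 c' χ + (frake0 + frake 1) * frakA χ * frakP D)‖ +
        ‖xi15 c' χ - (e1star + 2 * e2star) * frakA χ * frakP D‖ := by
          refine le_trans (norm_add_le _ _) ?_
          gcongr
          refine le_trans (norm_add_le _ _) ?_
          gcongr
          refine le_trans (norm_add_le _ _) ?_
          gcongr
          exact norm_add_le _ _
    _ ≤ ε / 5 * frakP D + ε / 5 * frakP D + ε / 5 * frakP D + ε / 5 * frakP D +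
        (1e-5 * frakA χ * frakP D + ε / 5 * frakP D) := by
          rw [norm_mul, norm_mul, norm_mul, nI, Complex.norm_I, one_mul, one_mul, one_mul]
          gcongr
    _ = 1e-5 * frakA χ * frakP D + ε * frakP D := by ring

/-! ## The whole DAG: Theorem 1 from the LEAF claims of the manuscript -/

section WholeDAG

variable (c' : ℝ)

/-- **§7 pp. 13–15, the proof of Proposition 7.1** ((7.3): "By Proposition 2.1 … the sum over
`ψ ∈ Ψ₁` can be extended to `Ψ`"; (7.4)–(7.5): Cauchy and the large sieve / Lemma 3.3; (7.6)–(7.15):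
Lemmas 5.3, 5.4, 5.6; (7.16)–(7.21): Lemmas 5.1–5.2 and the residues at `s = 1 − β_j`), as ONE
named implication. CLAIM. [cite: Zhang2022LandauSiegel, §7 pp. 13–15] -/
def Ded71 : Prop :=
  Prop21 → Lemma33a → Lemma33b → Lemma51 → Lemma52 c' → Lemma53 → Lemma54 → Lemma56 → Prop71 c'

/-- **§8 p. 16, the proof of Lemma 8.1** ("By Proposition 2.2, we can choose a rectangle 𝔯 …";
"By Lemma 5.9, the residue theorem …"; "By Lemma 5.2 and 5.9"; "By Cauchy's inequality, Lemma 6.1,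
and the second assertion of Lemma 3.3"), as ONE named implication. CLAIM.
[cite: Zhang2022LandauSiegel, §8 p. 16] -/
def Ded81 : Prop := Prop22 c' → Lemma33b → Lemma52 c' → Lemma59 c' → Lemma61 → Lemma81 c'

/-- **Lemma 5.5 is a theorem of the tree**: the manuscript states it without proof ("a weaker form of
the Deuring–Heilbronn phenomenon"); the tree PROVES the Deuring–Heilbronn phenomenon
(`deuring_heilbronn_holds`, Bombieri's Théorème 14) and `lemma55_holds_of` turns it into the node.
[cite: Zhang2022LandauSiegel, §5 Lemma 5.5] -/
theorem lemma55_holds : Lemma55 := lemma55_holds_of deuring_heilbronn_holds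

/-- **Theorem 1 from the leaf claims of the manuscript** (every edge kernel-checked; every hypothesis
a CLAIM of arXiv:2211.02515v1 stated as a named node, except `hm : Margin232`, the §18 numerical
margin — which is REFUTED in the kernel, `not_margin232`). For a constant `c′ ≥ 0` of (2.13) and any
`c₀` of (13.6). The composition: Prop. 2.1 ⇐ Lemmas 3.4–3.6; Prop. 7.1 ⇐ `Ded71`; Prop. 2.2 ⇐ `Ded22`;
Lemma 2.3 ⇐ `Ded23`; Lemma 8.1 ⇐ `Ded81`; (8.7), (9.1), (10.1), (18.3) ⇐ Lemma 8.1
(`SkeletonReductions`); (8.23), (9.7), (10.17), the (18.3)-bound, (11.1), (12.17), (15.24), (16.17),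
(17.10) ⇐ the `Ded…` computations; (13.7)+(13.11) ⇒ `Eval137`; (18.1) ⇐ `eval181_of_parts`;
Theorem 1 ⇐ `theorem1_of_evaluations`. [cite: Zhang2022LandauSiegel, §2 p. 6] -/
theorem theorem1_of_leaves {c' c₀ : ℝ} (hc' : 0 ≤ c')
    -- §3 and §4
    (h34 : Lemma34) (h35 : Lemma35) (h36 : Lemma36) (h33a : Lemma33a) (h33b : Lemma33b)
    (h42 : Lemma42) (h45 : Lemma45) (h46 : Lemma46 c') (h47 : Lemma47 c')
    (hD22 : Ded22 c') (hD23 : Ded23 c')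
    -- §5 and §6
    (h51 : Lemma51) (h52 : Lemma52 c') (h53 : Lemma53) (h54 : Lemma54) (h59 : Lemma59 c')
    (h61 : Lemma61)
    -- §7 and §8
    (hD71 : Ded71 c') (hD81 : Ded81 c') (h83 : Lemma83 c') (h84 : Lemma84 c')
    (hD823 : Ded823 c') (hD97 : Ded97 c')
    -- §10, §11, §18
    (h101 : Lemma101 c') (h102 : Lemma102 c') (hD1017 : Ded1017 c') (hD183 : Ded183 c')
    (h111 : Lemma111) (h112 : Lemma112) (hD111 : Ded111 c')
    -- §§12–17
    (h121 : Lemma121 c') (h123 : Lemma123 c') (hD1217 : Ded1217 c') (h137 : Eq137 c' c₀)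
    (h1311 : Eq1311 c' c₀) (h141 : Prop141)
    (h151 : Lemma151 c') (hD1524 : Ded1524 c') (hD1617 : Ded1617 c') (hD1710 : Ded1710 c')
    -- the numerical margin of §18 (REFUTED: `not_margin232`)
    (hm : Margin232) : Theorem1 := by
  -- Part I
  have h21 : Prop21 := prop21_of_lemmas h34 h35 h36
  have h22 : Prop22 c' := hD22 h42 h45 h46 h47
  have h22i : Prop22i := h22.1
  have h23 : Lemma23 c' := hD23 h22
  have h56 : Lemma56 := lemma56_holds
  have h58 : Lemma58 := lemma58_holds
  have h55 : Lemma55 := lemma55_holds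
  -- the mean-value formulas and Lemma 8.1
  have h71 : Prop71 c' := hD71 h21 h33a h33b h51 h52 h53 h54 h56
  have h81 : Lemma81 c' := hD81 h22 h33b h52 h59 h61
  have h82 : Lemma82 c' := lemma82_holds hc'
  -- the "By Lemma 8.1" reductions
  have h87 : Eq87 c' := eq87_of h22i h23 h81
  have h91 : Eq91 c' := eq91_of h22i h23 h81
  have hE101 : Eq101 c' := eq101_of h22i h23 h81
  have hE183 : Eq183 c' := eq183_of h22i h23 h81
  -- the evaluations
  have h823 : Eval823 c' := eval823_of c' h87 h71 h82 h83 h84 hD823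
  have h97 : Eval97 c' := eval97_of c' h91 h71 h82 h83 h84 hD97
  have h1017 : Eval1017 c' := eval1017_of c' hE101 h71 h82 h83 h84 h101 h102 hD1017
  have hB183 : Bound183 c' := bound183_of c' hE183 h71 h101 h102 hD183
  have hE111 : Eval111 c' := eval111_of c' h111 h112 h81 h71 hD111
  have h1217 : Eval1217 c' := hD1217 h71 h81 h82 h83 h84 h58 h121 h123
  have hE137 : Eval137 c' := eval137_of c' c₀ h137 h1311
  have h1524 : Eval1524 c' := hD1524 h141 h55 h58 h151
  have h1617 : Eval1617 c' := hD1617 h141 h55 h58 h151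
  have h1710 : Eval1710 c' := hD1710 h141 appBLemma171_holds h151
  have h181 : Eval181 c' := eval181_of_parts h1217 hE137 h1524 h1617 h1710
  exact theorem1_of_evaluations h22i h23 h1017 h823 h97 h181 hm hB183 hE111

/-- **Theorem 2 from the same leaves** (§1: "a direct consequence of Theorem 1").
[cite: Zhang2022LandauSiegel, §1 Theorem 2] -/
theorem theorem2_of_leaves {c' c₀ : ℝ} (hc' : 0 ≤ c')
    (h34 : Lemma34) (h35 : Lemma35) (h36 : Lemma36) (h33a : Lemma33a) (h33b : Lemma33b)
    (h42 : Lemma42) (h45 : Lemma45) (h46 : Lemma46 c') (h47 : Lemma47 c')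
    (hD22 : Ded22 c') (hD23 : Ded23 c')
    (h51 : Lemma51) (h52 : Lemma52 c') (h53 : Lemma53) (h54 : Lemma54) (h59 : Lemma59 c')
    (h61 : Lemma61)
    (hD71 : Ded71 c') (hD81 : Ded81 c') (h83 : Lemma83 c') (h84 : Lemma84 c')
    (hD823 : Ded823 c') (hD97 : Ded97 c')
    (h101 : Lemma101 c') (h102 : Lemma102 c') (hD1017 : Ded1017 c') (hD183 : Ded183 c')
    (h111 : Lemma111) (h112 : Lemma112) (hD111 : Ded111 c')
    (h121 : Lemma121 c') (h123 : Lemma123 c') (hD1217 : Ded1217 c') (h137 : Eq137 c' c₀)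
    (h1311 : Eq1311 c' c₀) (h141 : Prop141)
    (h151 : Lemma151 c') (hD1524 : Ded1524 c') (hD1617 : Ded1617 c') (hD1710 : Ded1710 c')
    (hm : Margin232) : Theorem2 :=
  theorem2_of_theorem1 (theorem1_of_leaves hc' h34 h35 h36 h33a h33b h42 h45 h46 h47 hD22 hD23
    h51 h52 h53 h54 h59 h61 hD71 hD81 h83 h84 hD823 hD97 h101 h102 hD1017 hD183 h111 h112 hD111
    h121 h123 hD1217 h137 h1311 h141 h151 hD1524 hD1617 hD1710 hm)

/-- **The margin fails for EVERY admissible rounding term.** The manuscript's `𝔠₃` is the explicit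
`frakc3` plus a rounding term `ε`, "`|ε| < 10⁻⁵`" (§8 p. 18, §18); for every real `ε` with
`|ε| ≤ 10⁻⁵`, and with either reading of the (9.5)–(9.6) prefactor (`frakc2` as printed, `frakc2c`
corrected), `𝔠₁ + 𝔠₂ + 2(Re 𝔠₃ + ε) > 0.05 > 0.001` (tree certificates `frakc1_re_bounds`,
`frakc2_re_bounds`, `frakc2c_re_bounds`, `frakc3_re_bounds`). So the §18 sentence "𝔠₁ + 𝔠₂ + 2Re{𝔠₃}
< 0.001" is false as the constants are defined, whatever the rounding. [cite: Zhang2022LandauSiegel, §18 p. 36] -/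
theorem margin_fails_all_roundings (ε : ℝ) (hε : |ε| ≤ 1e-5) :
    0.05 < frakc1.re + frakc2.re + 2 * (frakc3.re + ε) ∧
      0.05 < frakc1.re + frakc2c.re + 2 * (frakc3.re + ε) := by
  have h1 := frakc1_re_bounds.1
  have h2 := frakc2_re_bounds.1
  have h2c := frakc2c_re_bounds.1
  have h3 := frakc3_re_bounds.1
  have hε' := (abs_le.mp hε).1
  constructor <;> linarith

end WholeDAG

end Literature.NumberTheory.LFunctions.Zhang2022.Skeleton
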